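import Mathlib
import Literature.Analysis.FluidPDE.KNSSMildDecayHorizontal
import Literature.Analysis.FluidPDE.EnergyToolkit
import Literature.Analysis.UnboundedOperators.HeatKernelBoundedData

/-!
# Crux `SlicedKelvin.PlanarFluxAPriori` (stmt-NavierStokesRegularity-15600), line `registered`,
# stub `stub_decayPersistence` — directional derivatives of the Oseen representation

Support file (theorems only) for the decay-persistence stub. To propagate spatial decay to the
derivatives of a bounded classical solution along its Oseen (mild) representation
`u(τ) = e^{ντΔ}u(0) - B^ν_0(u,u)(τ)` (Brandolese 2004; Kukavica–Torres 2006), the representation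
is differentiated along lines `θ ↦ x + θw`: the derivative falls on the **fields**, not on the
kernel,

* `decay_hasDerivAt_heatExtension_line` — `∂_w e^{sΔ} f = e^{sΔ} ∂_w f` for bounded `C¹` data
  with bounded derivative (the tree's `fderiv_heatExtension_apply_of_bounded`);
* `decay_oseenDuhamel_eq_integral_shift` — after the substitution `y ↦ z - y` the Duhamel term
  is the absolutely convergent product integral `∫_{(0,τ)×ℝ³} K(ν(τ-σ), y)[a(σ, z-y), b(σ, z-y)]`;
* `decay_hasDerivAt_oseenDuhamel_line` — for jointly smooth fields `a`, `b` bounded together with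
  their spatial derivatives on `[0, τ]`,
  `∂_w B^ν_0(a, b)(τ) = B^ν_0(∂_w a, b)(τ) + B^ν_0(a, ∂_w b)(τ)` (differentiation under the
  product integral, dominated by `C (ν(τ-σ) + |y|²)^{-2}`);
* `decay_fderiv_of_representation` — hence a field represented by `e^{ντΔ}g(0)` and finitely
  many Duhamel terms has directional derivatives represented in the same way by the
  Leibniz-expanded family of terms.

## References

* L. Brandolese, Math. Ann. 329 (2004) = arXiv:math/0403136.
* I. Kukavica, J. J. Torres, Nonlinearity 19 (2006).
* G. Koch, N. Nadirashvili, G. Seregin, V. Šverák, Acta Math. 203 (2009), §3 (3.8), §4.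
-/

noncomputable section

-- the summit and its single sub-problem share the name (CONVENTIONS §1), as in every Theorems file
set_option linter.dupNamespace false

namespace Summit.NavierStokesRegularity.NavierStokesRegularity.Theorems.SlicedKelvinPlanarFluxAPriori

open MeasureTheory Set Filter Topology Metric Real Function
open scoped ENNReal NNReal
open Literature.Analysis.FluidPDE Literature.Analysis.UnboundedOperators

/-! ### The caloric term -/

/-- **Directional derivatives fall on bounded `C¹` data**: for `f ∈ C¹(ℝ³)` bounded with bounded
derivative and `s > 0`, `θ ↦ e^{sΔ} f (x + θw)` has derivative `e^{sΔ}(∂_w f)(x)` at `θ = 0`. -/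
theorem decay_hasDerivAt_heatExtension_line {f : EuclideanSpace ℝ (Fin 3) → EuclideanSpace ℝ (Fin 3)}
    (hf : ContDiff ℝ 1 f) {C₀ C₁ : ℝ} (h0 : ∀ z, ‖f z‖ ≤ C₀) (h1 : ∀ z, ‖fderiv ℝ f z‖ ≤ C₁)
    {s : ℝ} (hs : 0 < s) (x w : EuclideanSpace ℝ (Fin 3)) :
    HasDerivAt (fun θ : ℝ => heatExtension f s (x + θ • w))
      (heatExtension (fun z => fderiv ℝ f z w) s x) 0 := by
  have hdiff : Differentiable ℝ (heatExtension f s) :=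
    (contDiff_heatExtension_of_bound hf.continuous h0 hs (m := 1)).differentiable (by simp)
  have hline : HasDerivAt (fun θ : ℝ => x + θ • w) w 0 := by
    simpa using ((hasDerivAt_id (0 : ℝ)).smul_const w).const_add x
  have hcomp := (hdiff (x + (0 : ℝ) • w)).hasFDerivAt.comp_hasDerivAt (0 : ℝ) hline
  have h1' : ∀ z, ‖fderiv ℝ f z w‖ ≤ C₁ * ‖w‖ := fun z => (fderiv ℝ f z).le_of_opNorm_le (h1 z) w
  rw [zero_smul, add_zero, fderiv_heatExtension_apply_of_bounded hf h0 h1' hs x] at hcomp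
  exact hcomp

/-! ### The Duhamel term as a shifted product integral -/

/-- **The Duhamel term after the substitution `y ↦ z - y`.** For fields `a`, `b` continuous on
`[0, T) × ℝ³` and bounded by `M` on `[0, τ]`, `0 < τ < T`, `ν > 0`, the integrand
`(σ, y) ↦ K(ν(τ-σ), y)[a(σ, z-y), b(σ, z-y)]` is integrable on `(0, τ) × ℝ³` and its integral is
`B^ν_0(a, b)(τ)(z)` (Fubini for the absolutely convergent Duhamel integral,
`oseenDuhamel_eq_integral_prod`, and the measure-preserving shear `(σ, y) ↦ (σ, z - y)`). -/
theorem decay_oseenDuhamel_eq_integral_shift {ν T : ℝ} (hν : 0 < ν)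
    {a b : ℝ → EuclideanSpace ℝ (Fin 3) → EuclideanSpace ℝ (Fin 3)}
    (ha : ContinuousOn (uncurry a) (Ico 0 T ×ˢ univ)) (hb : ContinuousOn (uncurry b) (Ico 0 T ×ˢ univ))
    {τ : ℝ} (hτ : 0 < τ) (hτT : τ < T) {M : ℝ} (hM : 0 ≤ M)
    (haM : ∀ σ ∈ Icc 0 τ, ∀ y, ‖a σ y‖ ≤ M) (hbM : ∀ σ ∈ Icc 0 τ, ∀ y, ‖b σ y‖ ≤ M)
    (z : EuclideanSpace ℝ (Fin 3)) :
    Integrable (fun q : ℝ × EuclideanSpace ℝ (Fin 3) =>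
        oseenKernel (ν * (τ - q.1)) q.2 (a q.1 (z - q.2)) (b q.1 (z - q.2)))
      ((volume : Measure (ℝ × EuclideanSpace ℝ (Fin 3))).restrict (Ioo 0 τ ×ˢ univ)) ∧
    oseenDuhamel ν 0 a b τ z = ∫ q in Ioo 0 τ ×ˢ univ,
      oseenKernel (ν * (τ - q.1)) q.2 (a q.1 (z - q.2)) (b q.1 (z - q.2)) := by
  -- measurability and bounds on the open slab
  have hsub : Ioo 0 τ ×ˢ (univ : Set (EuclideanSpace ℝ (Fin 3))) ⊆ Ico 0 T ×ˢ univ :=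
    prod_mono (fun σ hσ => ⟨hσ.1.le, hσ.2.trans hτT⟩) subset_rfl
  have hmeas : MeasurableSet (Ioo 0 τ ×ˢ (univ : Set (EuclideanSpace ℝ (Fin 3)))) :=
    measurableSet_Ioo.prod MeasurableSet.univ
  have ham : AEStronglyMeasurable (uncurry a)
      ((volume : Measure (ℝ × EuclideanSpace ℝ (Fin 3))).restrict (Ioo 0 τ ×ˢ univ)) :=
    (ha.mono hsub).aestronglyMeasurable hmeas
  have hbm : AEStronglyMeasurable (uncurry b)
      ((volume : Measure (ℝ × EuclideanSpace ℝ (Fin 3))).restrict (Ioo 0 τ ×ˢ univ)) :=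
    (hb.mono hsub).aestronglyMeasurable hmeas
  have haM' : ∀ σ ∈ Ioo 0 τ, ∀ y, ‖a σ y‖ ≤ M := fun σ hσ y => haM σ ⟨hσ.1.le, hσ.2.le⟩ y
  have hbM' : ∀ σ ∈ Ioo 0 τ, ∀ y, ‖b σ y‖ ≤ M := fun σ hσ y => hbM σ ⟨hσ.1.le, hσ.2.le⟩ y
  have hint := integrable_oseenKernel_duhamel_bounded hν ham hbm hM haM' hbM' hτ le_rfl z
  have heq := oseenDuhamel_eq_integral_prod hν ham hbm hM haM' hbM' hτ le_rfl z
  -- the shear `Ψ (σ, y) = (σ, z - y)` preserves the restricted volume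
  set Ψ : ℝ × EuclideanSpace ℝ (Fin 3) → ℝ × EuclideanSpace ℝ (Fin 3) :=
    Prod.map id (fun y => z - y) with hΨ
  have hΨemb : MeasurableEmbedding Ψ :=
    MeasurableEmbedding.id.prodMap (measurableEmbedding_subLeft z)
  have hΨvol : MeasurePreserving Ψ (volume : Measure (ℝ × EuclideanSpace ℝ (Fin 3))) volume := by
    have h := (MeasurePreserving.id (volume : Measure ℝ)).prod
      (Measure.measurePreserving_sub_left (volume : Measure (EuclideanSpace ℝ (Fin 3))) z)
    rwa [← Measure.volume_eq_prod] at h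
  have hpre : Ψ ⁻¹' (Ioo 0 τ ×ˢ (univ : Set (EuclideanSpace ℝ (Fin 3)))) = Ioo 0 τ ×ˢ univ := by
    ext q; simp [hΨ]
  have hΨS : MeasurePreserving Ψ
      ((volume : Measure (ℝ × EuclideanSpace ℝ (Fin 3))).restrict (Ioo 0 τ ×ˢ univ))
      ((volume : Measure (ℝ × EuclideanSpace ℝ (Fin 3))).restrict (Ioo 0 τ ×ˢ univ)) := by
    have h := hΨvol.restrict_preimage_emb hΨemb (Ioo 0 τ ×ˢ univ)
    rwa [hpre] at h
  have hcompΨ : ∀ q : ℝ × EuclideanSpace ℝ (Fin 3),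
      oseenKernel (ν * (τ - (Ψ q).1)) (z - (Ψ q).2) (a (Ψ q).1 (Ψ q).2) (b (Ψ q).1 (Ψ q).2) =
        oseenKernel (ν * (τ - q.1)) q.2 (a q.1 (z - q.2)) (b q.1 (z - q.2)) := by
    intro q
    simp [hΨ, sub_sub_cancel]
  constructor
  · have h := (hΨS.integrable_comp_emb hΨemb).2 hint
    refine h.congr (Eventually.of_forall fun q => ?_)
    exact hcompΨ q
  · rw [heq, ← hΨS.integral_comp hΨemb]
    exact integral_congr_ae (Eventually.of_forall fun q => hcompΨ q)

/-- The parabolic majorant is integrable on `(0, τ) × ℝ³`: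
`∫_{(0,τ)} ∫ (ν(τ-σ) + |y|²)^{-2} dy dσ = M₃ ν^{-1/2} · 2√τ < ∞`. -/
theorem decay_integrable_majorant_prod {ν : ℝ} (hν : 0 < ν) {τ : ℝ} (hτ : 0 < τ) (C : ℝ) :
    Integrable (fun q : ℝ × EuclideanSpace ℝ (Fin 3) => C * (ν * (τ - q.1) + ‖q.2‖ ^ 2) ^ (-(2 : ℝ)))
      ((volume : Measure (ℝ × EuclideanSpace ℝ (Fin 3))).restrict (Ioo 0 τ ×ˢ univ)) := by
  have hfin : (Module.finrank ℝ (EuclideanSpace ℝ (Fin 3)) : ℝ) = 3 := by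
    rw [finrank_euclideanSpace_fin]; norm_num
  have he : (Module.finrank ℝ (EuclideanSpace ℝ (Fin 3)) : ℝ) < 2 * 2 := by rw [hfin]; norm_num
  have hmeas : Measurable fun q : ℝ × EuclideanSpace ℝ (Fin 3) =>
      (ν * (τ - q.1) + ‖q.2‖ ^ 2) ^ (-(2 : ℝ)) := by
    refine Measurable.pow_const ?_ _
    exact ((measurable_const.mul (measurable_const.sub measurable_fst))).add
      (measurable_snd.norm.pow_const 2)
  refine Integrable.const_mul ?_ C
  refine ⟨hmeas.aestronglyMeasurable, ?_⟩
  rw [hasFiniteIntegral_iff_enorm, volume_restrict_prod_univ_eq_prod]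
  set M₃ : ℝ := ∫ w : EuclideanSpace ℝ (Fin 3), (1 + ‖w‖ ^ 2) ^ (-(2 : ℝ)) with hM₃
  calc ∫⁻ q, ‖(ν * (τ - q.1) + ‖q.2‖ ^ 2) ^ (-(2 : ℝ))‖ₑ
        ∂((volume : Measure ℝ).restrict (Ioo 0 τ)).prod (volume : Measure (EuclideanSpace ℝ (Fin 3)))
      = ∫⁻ σ in Ioo 0 τ, ∫⁻ y : EuclideanSpace ℝ (Fin 3),
          ‖(ν * (τ - σ) + ‖y‖ ^ 2) ^ (-(2 : ℝ))‖ₑ := by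
        rw [lintegral_prod _ hmeas.enorm.aemeasurable]
    _ = ∫⁻ σ in Ioo 0 τ, ENNReal.ofReal ((ν * (τ - σ)) ^ (-(1 / 2 : ℝ)) * M₃) := by
        refine setLIntegral_congr_fun measurableSet_Ioo fun σ hσ => ?_
        have hs : 0 < ν * (τ - σ) := mul_pos hν (sub_pos.2 hσ.2)
        have h1 : ∀ y : EuclideanSpace ℝ (Fin 3), ‖(ν * (τ - σ) + ‖y‖ ^ 2) ^ (-(2 : ℝ))‖ₑ =
            ENNReal.ofReal ((ν * (τ - σ) + ‖y‖ ^ 2) ^ (-(2 : ℝ))) := fun y => by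
          rw [Real.enorm_eq_ofReal (Real.rpow_nonneg (by positivity) _)]
        simp_rw [h1]
        rw [lintegral_add_norm_sq_rpow_neg he hs, hfin, ← hM₃,
          show ((3 : ℝ) / 2 - 2) = -(1 / 2 : ℝ) by norm_num]
    _ = ENNReal.ofReal (ν ^ (-(1 / 2 : ℝ)) * M₃) *
          ∫⁻ σ in Ioo 0 τ, ENNReal.ofReal ((τ - σ) ^ (-(1 / 2 : ℝ))) := by
        rw [← lintegral_const_mul' _ _ ENNReal.ofReal_ne_top]
        refine setLIntegral_congr_fun measurableSet_Ioo fun σ hσ => ?_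
        have hts : 0 ≤ τ - σ := (sub_pos.2 hσ.2).le
        have hM₃0 : 0 ≤ M₃ := integral_nonneg fun w => Real.rpow_nonneg (by positivity) _
        rw [Real.mul_rpow hν.le hts, ← ENNReal.ofReal_mul (by positivity)]
        congr 1; ring
    _ < ⊤ := by
        rw [setLIntegral_Ioo_sub_rpow_neg_half_of_lt hτ]
        exact ENNReal.mul_lt_top ENNReal.ofReal_lt_top ENNReal.ofReal_lt_top

/-! ### Differentiating the Duhamel term along lines -/

/-- **The directional derivative of the Duhamel term falls on the fields.** Let `a`, `b` be
jointly smooth on `[0, T) × ℝ³`, with `a`, `b`, `Da`, `Db` bounded by `M` on `[0, τ] × ℝ³`,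
`0 < τ < T`, `ν > 0`. Then `θ ↦ B^ν_0(a,b)(τ)(x + θw)` has at `θ = 0` the derivative
`B^ν_0(∂_w a, b)(τ)(x) + B^ν_0(a, ∂_w b)(τ)(x)`, `∂_w a (σ, y) = D(a σ)(y) w` (differentiation
under the shifted product integral of `decay_oseenDuhamel_eq_integral_shift`, dominated by
`2 C₀ M² |w| (ν(τ-σ) + |y|²)^{-2}`). -/
theorem decay_hasDerivAt_oseenDuhamel_line {ν T : ℝ} (hν : 0 < ν)
    {a b : ℝ → EuclideanSpace ℝ (Fin 3) → EuclideanSpace ℝ (Fin 3)}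
    (ha : IsSmoothSpaceTimeOn (Ico 0 T) a) (hb : IsSmoothSpaceTimeOn (Ico 0 T) b)
    {τ : ℝ} (hτ : 0 < τ) (hτT : τ < T) {M : ℝ} (hM : 0 ≤ M)
    (haM : ∀ σ ∈ Icc 0 τ, ∀ y, ‖a σ y‖ ≤ M) (hbM : ∀ σ ∈ Icc 0 τ, ∀ y, ‖b σ y‖ ≤ M)
    (haM' : ∀ σ ∈ Icc 0 τ, ∀ y, ‖fderiv ℝ (a σ) y‖ ≤ M)
    (hbM' : ∀ σ ∈ Icc 0 τ, ∀ y, ‖fderiv ℝ (b σ) y‖ ≤ M) (x w : EuclideanSpace ℝ (Fin 3)) :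
    HasDerivAt (fun θ : ℝ => oseenDuhamel ν 0 a b τ (x + θ • w))
      (oseenDuhamel ν 0 (fun σ y => fderiv ℝ (a σ) y w) b τ x +
        oseenDuhamel ν 0 a (fun σ y => fderiv ℝ (b σ) y w) τ x) 0 := by
  obtain ⟨C₀, hC₀, hK⟩ := exists_norm_oseenKernel_three_le
  -- the directional derivative fields are jointly smooth and bounded by `M |w|`
  have hda : IsSmoothSpaceTimeOn (Ico 0 T) (fun σ y => fderiv ℝ (a σ) y w) :=
    ha.fderiv_slice_apply (uniqueDiffOn_Ico 0 T) w
  have hdb : IsSmoothSpaceTimeOn (Ico 0 T) (fun σ y => fderiv ℝ (b σ) y w) :=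
    hb.fderiv_slice_apply (uniqueDiffOn_Ico 0 T) w
  have hdaM : ∀ σ ∈ Icc 0 τ, ∀ y, ‖fderiv ℝ (a σ) y w‖ ≤ M * ‖w‖ := fun σ hσ y =>
    (fderiv ℝ (a σ) y).le_of_opNorm_le (haM' σ hσ y) w
  have hdbM : ∀ σ ∈ Icc 0 τ, ∀ y, ‖fderiv ℝ (b σ) y w‖ ≤ M * ‖w‖ := fun σ hσ y =>
    (fderiv ℝ (b σ) y).le_of_opNorm_le (hbM' σ hσ y) w
  set M' : ℝ := max M (M * ‖w‖) with hM'
  have hMM' : M ≤ M' := le_max_left _ _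
  have hM'0 : 0 ≤ M' := hM.trans hMM'
  have haM₁ : ∀ σ ∈ Icc 0 τ, ∀ y, ‖a σ y‖ ≤ M' := fun σ hσ y => (haM σ hσ y).trans hMM'
  have hbM₁ : ∀ σ ∈ Icc 0 τ, ∀ y, ‖b σ y‖ ≤ M' := fun σ hσ y => (hbM σ hσ y).trans hMM'
  have hdaM₁ : ∀ σ ∈ Icc 0 τ, ∀ y, ‖fderiv ℝ (a σ) y w‖ ≤ M' := fun σ hσ y =>
    (hdaM σ hσ y).trans (le_max_right _ _)
  have hdbM₁ : ∀ σ ∈ Icc 0 τ, ∀ y, ‖fderiv ℝ (b σ) y w‖ ≤ M' := fun σ hσ y =>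
    (hdbM σ hσ y).trans (le_max_right _ _)
  -- the integrands
  set μ : Measure (ℝ × EuclideanSpace ℝ (Fin 3)) :=
    (volume : Measure (ℝ × EuclideanSpace ℝ (Fin 3))).restrict (Ioo 0 τ ×ˢ univ) with hμ
  set F : ℝ → ℝ × EuclideanSpace ℝ (Fin 3) → EuclideanSpace ℝ (Fin 3) := fun θ q =>
    oseenKernel (ν * (τ - q.1)) q.2 (a q.1 (x + θ • w - q.2)) (b q.1 (x + θ • w - q.2)) with hF
  set F' : ℝ → ℝ × EuclideanSpace ℝ (Fin 3) → EuclideanSpace ℝ (Fin 3) := fun θ q =>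
    oseenKernel (ν * (τ - q.1)) q.2 (fderiv ℝ (a q.1) (x + θ • w - q.2) w) (b q.1 (x + θ • w - q.2)) +
      oseenKernel (ν * (τ - q.1)) q.2 (a q.1 (x + θ • w - q.2)) (fderiv ℝ (b q.1) (x + θ • w - q.2) w)
    with hF'
  -- the shifted-integral representations
  have hrep : ∀ θ : ℝ, Integrable (F θ) μ ∧ oseenDuhamel ν 0 a b τ (x + θ • w) = ∫ q, F θ q ∂μ :=
    fun θ => decay_oseenDuhamel_eq_integral_shift hν ha.continuousOn hb.continuousOn hτ hτT hM'0
      haM₁ hbM₁ (x + θ • w)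
  have hrep₁ := decay_oseenDuhamel_eq_integral_shift hν hda.continuousOn hb.continuousOn hτ hτT hM'0
    hdaM₁ hbM₁ x
  have hrep₂ := decay_oseenDuhamel_eq_integral_shift hν ha.continuousOn hdb.continuousOn hτ hτT hM'0
    haM₁ hdbM₁ x
  have hF'0 : F' 0 = fun q => oseenKernel (ν * (τ - q.1)) q.2 (fderiv ℝ (a q.1) (x - q.2) w) (b q.1 (x - q.2)) +
      oseenKernel (ν * (τ - q.1)) q.2 (a q.1 (x - q.2)) (fderiv ℝ (b q.1) (x - q.2) w) := by
    funext q; simp only [hF', zero_smul, add_zero]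
  -- differentiate under the integral
  set bound : ℝ × EuclideanSpace ℝ (Fin 3) → ℝ := fun q =>
    (2 * C₀ * M' * M') * (ν * (τ - q.1) + ‖q.2‖ ^ 2) ^ (-(2 : ℝ)) with hbound
  have hae : ∀ᵐ q ∂μ, q ∈ Ioo 0 τ ×ˢ (univ : Set (EuclideanSpace ℝ (Fin 3))) :=
    ae_restrict_mem (measurableSet_Ioo.prod MeasurableSet.univ)
  have hline : ∀ (y : EuclideanSpace ℝ (Fin 3)) (θ : ℝ), HasDerivAt (fun θ : ℝ => x + θ • w - y) w θ := by
    intro y θ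
    simpa using (((hasDerivAt_id θ).smul_const w).const_add x).sub_const y
  have hderiv : ∀ σ ∈ Ioo 0 τ, ∀ (y : EuclideanSpace ℝ (Fin 3)) (θ : ℝ),
      HasDerivAt (fun θ : ℝ => oseenKernel (ν * (τ - σ)) y (a σ (x + θ • w - y)) (b σ (x + θ • w - y)))
        (oseenKernel (ν * (τ - σ)) y (fderiv ℝ (a σ) (x + θ • w - y) w) (b σ (x + θ • w - y)) +
          oseenKernel (ν * (τ - σ)) y (a σ (x + θ • w - y)) (fderiv ℝ (b σ) (x + θ • w - y) w)) θ := by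
    intro σ hσ y θ
    have hσT : σ ∈ Ico 0 T := ⟨hσ.1.le, hσ.2.trans hτT⟩
    have hda' : DifferentiableAt ℝ (a σ) (x + θ • w - y) :=
      ((ha.contDiff_slice hσT).differentiable (by simp)).differentiableAt
    have hdb' : DifferentiableAt ℝ (b σ) (x + θ • w - y) :=
      ((hb.contDiff_slice hσT).differentiable (by simp)).differentiableAt
    have hA : HasDerivAt (fun θ : ℝ => a σ (x + θ • w - y)) (fderiv ℝ (a σ) (x + θ • w - y) w) θ :=
      hda'.hasFDerivAt.comp_hasDerivAt θ (hline y θ)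
    have hB : HasDerivAt (fun θ : ℝ => b σ (x + θ • w - y)) (fderiv ℝ (b σ) (x + θ • w - y) w) θ :=
      hdb'.hasFDerivAt.comp_hasDerivAt θ (hline y θ)
    have hKd : HasFDerivAt (fun v : EuclideanSpace ℝ (Fin 3) => oseenKernelCLM (ν * (τ - σ)) y v)
        (oseenKernelCLM (ν * (τ - σ)) y) (a σ (x + θ • w - y)) :=
      (oseenKernelCLM (ν * (τ - σ)) y).hasFDerivAt
    have hc : HasDerivAt (fun θ : ℝ => oseenKernelCLM (ν * (τ - σ)) y (a σ (x + θ • w - y)))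
        (oseenKernelCLM (ν * (τ - σ)) y (fderiv ℝ (a σ) (x + θ • w - y) w)) θ :=
      hKd.comp_hasDerivAt θ hA
    have h := hc.clm_apply hB
    simp only [oseenKernelCLM_apply] at h
    exact h
  have hbnd : ∀ σ ∈ Ioo 0 τ, ∀ (y : EuclideanSpace ℝ (Fin 3)) (θ : ℝ),
      ‖oseenKernel (ν * (τ - σ)) y (fderiv ℝ (a σ) (x + θ • w - y) w) (b σ (x + θ • w - y)) +
          oseenKernel (ν * (τ - σ)) y (a σ (x + θ • w - y)) (fderiv ℝ (b σ) (x + θ • w - y) w)‖ ≤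
        (2 * C₀ * M' * M') * (ν * (τ - σ) + ‖y‖ ^ 2) ^ (-(2 : ℝ)) := by
    intro σ hσ y θ
    have hσ' : σ ∈ Icc 0 τ := ⟨hσ.1.le, hσ.2.le⟩
    have hs : 0 < ν * (τ - σ) := mul_pos hν (sub_pos.2 hσ.2)
    have hk0 : 0 ≤ (ν * (τ - σ) + ‖y‖ ^ 2) ^ (-(2 : ℝ)) := Real.rpow_nonneg (by positivity) _
    refine (norm_add_le _ _).trans ?_
    have h1 := hK hs y (fderiv ℝ (a σ) (x + θ • w - y) w) (b σ (x + θ • w - y))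
    have h2 := hK hs y (a σ (x + θ • w - y)) (fderiv ℝ (b σ) (x + θ • w - y) w)
    have hCk : 0 ≤ C₀ * (ν * (τ - σ) + ‖y‖ ^ 2) ^ (-(2 : ℝ)) := mul_nonneg hC₀.le hk0
    have hCkM : 0 ≤ C₀ * (ν * (τ - σ) + ‖y‖ ^ 2) ^ (-(2 : ℝ)) * M' := mul_nonneg hCk hM'0
    have e1 : C₀ * (ν * (τ - σ) + ‖y‖ ^ 2) ^ (-(2 : ℝ)) * ‖fderiv ℝ (a σ) (x + θ • w - y) w‖ *
        ‖b σ (x + θ • w - y)‖ ≤ C₀ * (ν * (τ - σ) + ‖y‖ ^ 2) ^ (-(2 : ℝ)) * M' * M' :=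
      mul_le_mul (mul_le_mul_of_nonneg_left (hdaM₁ σ hσ' _) hCk) (hbM₁ σ hσ' _) (norm_nonneg _) hCkM
    have e2 : C₀ * (ν * (τ - σ) + ‖y‖ ^ 2) ^ (-(2 : ℝ)) * ‖a σ (x + θ • w - y)‖ *
        ‖fderiv ℝ (b σ) (x + θ • w - y) w‖ ≤ C₀ * (ν * (τ - σ) + ‖y‖ ^ 2) ^ (-(2 : ℝ)) * M' * M' :=
      mul_le_mul (mul_le_mul_of_nonneg_left (haM₁ σ hσ' _) hCk) (hdbM₁ σ hσ' _) (norm_nonneg _) hCkM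
    linarith
  have hmain := hasDerivAt_integral_of_dominated_loc_of_deriv_le (μ := μ) (F := F) (F' := F')
    (x₀ := (0 : ℝ)) (bound := bound) (s := ball 0 1) (ball_mem_nhds _ one_pos)
    (Eventually.of_forall fun θ => (hrep θ).1.aestronglyMeasurable) (hrep 0).1
    (by rw [hF'0]; exact (hrep₁.1.add hrep₂.1).aestronglyMeasurable)
    (by filter_upwards [hae] with q hq using fun θ _ => hbnd q.1 hq.1 q.2 θ)
    (decay_integrable_majorant_prod hν hτ _)
    (by filter_upwards [hae] with q hq using fun θ _ => hderiv q.1 hq.1 q.2 θ)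
  -- identify the two sides
  have hfun : (fun θ : ℝ => ∫ q, F θ q ∂μ) = fun θ => oseenDuhamel ν 0 a b τ (x + θ • w) := by
    funext θ; exact ((hrep θ).2).symm
  have hval : ∫ q, F' 0 q ∂μ = oseenDuhamel ν 0 (fun σ y => fderiv ℝ (a σ) y w) b τ x +
      oseenDuhamel ν 0 a (fun σ y => fderiv ℝ (b σ) y w) τ x := by
    rw [hF'0, integral_add hrep₁.1 hrep₂.1, hrep₁.2, hrep₂.2]
  have h := hmain.2
  rw [hfun, hval] at h
  exact h

/-! ### The representation of a directional derivative -/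

/-- **Directional derivatives of a represented field.** If on `ℝ³` the slice `g(τ)` of a field is
represented as `g(τ, z) = e^{ντΔ} g(0) (z) - Σᵢ B^ν_0(aᵢ, bᵢ)(τ)(z)` by finitely many Duhamel terms
of jointly smooth fields bounded with their derivatives on `[0, τ]`, `0 < τ < T`, and `g(0)` is
`C¹`, bounded with bounded derivative, `g(τ)` differentiable, then
`D(g τ)(x) w = e^{ντΔ}(∂_w g(0))(x) - Σᵢ (B^ν_0(∂_w aᵢ, bᵢ) + B^ν_0(aᵢ, ∂_w bᵢ))(τ)(x)`. -/
theorem decay_fderiv_of_representation :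
    ∀ {ν T : ℝ} (hν : 0 < ν) {ι : Type} [Fintype ι]
    {g : ℝ → EuclideanSpace ℝ (Fin 3) → EuclideanSpace ℝ (Fin 3)}
    {a b : ι → ℝ → EuclideanSpace ℝ (Fin 3) → EuclideanSpace ℝ (Fin 3)} {τ : ℝ} (hτ : 0 < τ)
    (hτT : τ < T) {M : ℝ} (hM : 0 ≤ M) (hg0 : ContDiff ℝ 1 (g 0)) (hg0M : ∀ z, ‖g 0 z‖ ≤ M)
    (hg0M' : ∀ z, ‖fderiv ℝ (g 0) z‖ ≤ M) (hgτ : Differentiable ℝ (g τ))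
    (ha : ∀ i, Literature.Analysis.FluidPDE.IsSmoothSpaceTimeOn (Set.Ico 0 T) (a i))
    (hb : ∀ i, Literature.Analysis.FluidPDE.IsSmoothSpaceTimeOn (Set.Ico 0 T) (b i))
    (haM : ∀ i, ∀ σ ∈ Set.Icc 0 τ, ∀ y, ‖a i σ y‖ ≤ M ∧ ‖fderiv ℝ (a i σ) y‖ ≤ M)
    (hbM : ∀ i, ∀ σ ∈ Set.Icc 0 τ, ∀ y, ‖b i σ y‖ ≤ M ∧ ‖fderiv ℝ (b i σ) y‖ ≤ M)
    (hrep : ∀ z, g τ z = Literature.Analysis.UnboundedOperators.heatExtension (g 0) (ν * τ) z -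
      ∑ i, Literature.Analysis.FluidPDE.oseenDuhamel ν 0 (a i) (b i) τ z)
    (x w : EuclideanSpace ℝ (Fin 3)),
    fderiv ℝ (g τ) x w =
      Literature.Analysis.UnboundedOperators.heatExtension (fun z => fderiv ℝ (g 0) z w) (ν * τ) x -
        ∑ i, (Literature.Analysis.FluidPDE.oseenDuhamel ν 0 (fun σ y => fderiv ℝ (a i σ) y w) (b i) τ x +
          Literature.Analysis.FluidPDE.oseenDuhamel ν 0 (a i) (fun σ y => fderiv ℝ (b i σ) y w) τ x) := by
  intro ν T hν ι _ g a b τ hτ hτT M hM hg0 hg0M hg0M' hgτ ha hb haM hbM hrep x w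
  -- the derivative along the line through the representation
  have hheat := decay_hasDerivAt_heatExtension_line hg0 hg0M hg0M' (mul_pos hν hτ) x w
  have hterm : ∀ i, HasDerivAt (fun θ : ℝ => oseenDuhamel ν 0 (a i) (b i) τ (x + θ • w))
      (oseenDuhamel ν 0 (fun σ y => fderiv ℝ (a i σ) y w) (b i) τ x +
        oseenDuhamel ν 0 (a i) (fun σ y => fderiv ℝ (b i σ) y w) τ x) 0 := fun i =>
    decay_hasDerivAt_oseenDuhamel_line hν (ha i) (hb i) hτ hτT hM (fun σ hσ y => (haM i σ hσ y).1)
      (fun σ hσ y => (hbM i σ hσ y).1) (fun σ hσ y => (haM i σ hσ y).2)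
      (fun σ hσ y => (hbM i σ hσ y).2) x w
  have hsum := HasDerivAt.fun_sum (u := Finset.univ) fun i _ => hterm i
  have hrhs := hheat.sub hsum
  -- the derivative along the line through `g τ`
  have hline : HasDerivAt (fun θ : ℝ => x + θ • w) w 0 := by
    simpa using ((hasDerivAt_id (0 : ℝ)).smul_const w).const_add x
  have hlhs : HasDerivAt (fun θ : ℝ => g τ (x + θ • w)) (fderiv ℝ (g τ) x w) 0 := by
    have h := (hgτ (x + (0 : ℝ) • w)).hasFDerivAt.comp_hasDerivAt (0 : ℝ) hline
    rwa [zero_smul, add_zero] at h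
  have hfun : (fun θ : ℝ => g τ (x + θ • w)) = fun θ =>
      heatExtension (g 0) (ν * τ) (x + θ • w) - ∑ i, oseenDuhamel ν 0 (a i) (b i) τ (x + θ • w) := by
    funext θ; exact hrep _
  rw [hfun] at hlhs
  exact hlhs.unique hrhs

end Summit.NavierStokesRegularity.NavierStokesRegularity.Theorems.SlicedKelvinPlanarFluxAPriori

end
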